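import Summits.HodgeConjecture.HodgeCM.Model.Toy.TruncAlgAt_1

/-! PORT of `HodgeCM/Model/Toy/TruncAlgAt.lean` (HodgeCMPerL run 82) — part 2: continuation of `Summits.HodgeConjecture.HodgeCM.Model.Toy.TruncAlgAt_1` (split at a top-level declaration boundary by port_pkg.py; scope re-opened below; declarations unchanged). -/

-- port_pkg: scope re-opened for this part (file-level context, then the namespace/section stack open at the cut)
noncomputable section
open scoped TensorProduct
namespace HodgeCM
open Literature.AlgebraicGeometry.Motives (CMType)
namespace Universe
variable (U : Universe)
variable {U}
section Separation
variable (M : U.ModelAxioms) (hN1 : U.Fact_cupExterior) (hN2 : U.Fact_cup_hodge) (hN3 : U.Fact_pull_H0)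
  (hN4 : U.Fact_hodge_F0)
include M hN1
include hN2 hN3 hN4
omit M hN1 hN2 hN3 hN4 in
set_option smartUnfolding false in
/-- (Ported verbatim from the HodgeCMPerL package; no docstring in the source.) -/
theorem powTopAlg_truncAlgAt_of_le {k c : ℕ} (hkc : (k + 1) * Module.finrank ℚ cyclo7 / 2 ≤ c)
    (hHC : ∀ (n : ℕ) (Θ : Fin (n + 1) → CMType cyclo7), U.HC (U.cmProd cyclo7 Θ)) : (U.truncAlgAt c).PowTopAlg k := by
  intro Φ
  show U.hodgeClassesOf (U.cmProd cyclo7 _) _ ≤ (U.truncAlgAt c).alg (U.cmProd cyclo7 _) _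
  rw [U.truncAlgAt_alg_of_le hkc]
  exact hHC k _ _

set_option smartUnfolding false in
/-- (Ported verbatim from the HodgeCMPerL package; no docstring in the source.) -/
theorem not_powTopAlg_truncAlgAt_of_lt {k c : ℕ} (hck : c < (k + 1) * Module.finrank ℚ cyclo7 / 2) :
    ¬ (U.truncAlgAt c).PowTopAlg k := by
  haveI := cyclo7_isGalois
  obtain ⟨f, -, -⟩ := exists_face_admissible cyclo7 (by rw [cyclo7_finrank])
  intro h
  have h1 := h f.Φ
  change U.hodgeClassesOf (U.cmProd cyclo7 _) _ ≤ (U.truncAlgAt c).alg (U.cmProd cyclo7 _) _ at h1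
  rw [U.truncAlgAt_alg_of_lt hck] at h1
  exact hodgeClassesOf_pow_ne_bot M hN1 hN2 hN3 hN4 (by rw [cyclo7_finrank]) k f.Φ (eq_bot_iff.mpr h1)

/-- **Distinct cuts give distinct universes** once `HC` holds in `U` for the CM products over `ℚ(ζ₇)`: the top class of
`A_Φ^{k+1}` has codimension `3(k+1)`, and `3k + 2 < 3(k+1) ≤ 3k' + 2` for `k < k'`. -/
theorem truncAlgAt_injective (hHC : ∀ (n : ℕ) (Θ : Fin (n + 1) → CMType cyclo7), U.HC (U.cmProd cyclo7 Θ)) :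
    Function.Injective (fun k : ℕ => U.truncAlgAt (3 * k + 2)) := by
  have hp : ∀ k : ℕ, (k + 1) * Module.finrank ℚ cyclo7 / 2 = 3 * k + 3 := fun k => by rw [cyclo7_finrank]; omega
  have key : ∀ k k' : ℕ, k < k' → U.truncAlgAt (3 * k + 2) ≠ U.truncAlgAt (3 * k' + 2) := fun k k' hkk' he =>
    not_powTopAlg_truncAlgAt_of_lt M hN1 hN2 hN3 hN4 (by rw [hp k]; omega)
      ((congrArg (fun V : Universe => V.PowTopAlg k) he).mpr (U.powTopAlg_truncAlgAt_of_le (by rw [hp k]; omega) hHC))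
  intro k k' h
  rcases lt_trichotomy k k' with hlt | heq | hgt
  · exact absurd h (key k k' hlt)
  · exact heq
  · exact absurd h.symm (key k' k hgt)

end Separation

end Universe

/-! ## The toy instances `truncModelAt c := toyModel.truncAlgAt c` -/

namespace Toy

open Universe

/-- **The toy universe truncated at codimension `c`.** -/
def truncModelAt (c : ℕ) : Universe := toyModel.truncAlgAt c

/-- (Ported verbatim from the HodgeCMPerL package; no docstring in the source.) -/
theorem truncModelAt_two : truncModelAt 2 = truncModel := rfl

section

variable {c : ℕ} (hc : 2 ≤ c)
include hc

/-- (Ported verbatim from the HodgeCMPerL package; no docstring in the source.) -/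
theorem truncModelAt_modelAxioms : (truncModelAt c).ModelAxioms :=
  ModelAxioms.truncAlgAt toyModel_modelAxioms hc toyModel_tr_eq_zero

/-- (Ported verbatim from the HodgeCMPerL package; no docstring in the source.) -/
theorem truncModelAt_w_rk4 : (truncModelAt c).W_RK4 := (toyModel.truncAlgAt_w_rk4_iff hc).mpr toyModel_w_rk4

/-- **[QW8] sufficiency FAILS in `truncModelAt c`** for every `c ≥ 2`. -/
theorem not_truncModelAt_qw8Sufficiency : ¬ (truncModelAt c).Qw8Sufficiency :=
  not_qw8Sufficiency_truncAlgAt toyModel_modelAxioms toyModel_fact_cupExterior hc toyModel_w_rk4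

/-- **The face reduction FAILS in `truncModelAt c`** for every `c ≥ 2`. -/
theorem not_truncModelAt_faceReduction : ¬ (truncModelAt c).FaceReduction :=
  not_faceReduction_truncAlgAt toyModel_modelAxioms toyModel_fact_cupExterior toyModel_fact_cup_hodge
    toyModel_fact_pull_H0 toyModel_fact_hodge_F0 hc toyModel_w_rk4

/-- **F4 FAILS in `truncModelAt c`** for every `c ≥ 2`. -/
theorem not_truncModelAt_fact_cupAlg : ¬ (truncModelAt c).Fact_cupAlg :=
  not_fact_cupAlg_truncAlgAt toyModel_modelAxioms toyModel_fact_cupExterior toyModel_fact_cup_hodge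
    toyModel_fact_pull_H0 toyModel_fact_hodge_F0 hc (fact_cupAssoc exteriorHodgeData) toyModel_fact_gysinDescent
    toyModel_fact_dimProd toyModel_w_rk4 toyModel_tr_eq_zero

end

/-- (Ported verbatim from the HodgeCMPerL package; no docstring in the source.) -/
theorem truncModelAt_pohlmannSpan (c : ℕ) : (truncModelAt c).PohlmannSpan :=
  (toyModel.truncAlgAt_pohlmannSpan_iff c).mpr toyModel_pohlmannSpan'
/-- (Ported verbatim from the HodgeCMPerL package; no docstring in the source.) -/
theorem truncModelAt_pohlmannBasis (c : ℕ) : (truncModelAt c).PohlmannBasis :=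
  (toyModel.truncAlgAt_pohlmannBasis_iff c).mpr toyModel_pohlmannBasis'
/-- (Ported verbatim from the HodgeCMPerL package; no docstring in the source.) -/
theorem truncModelAt_fact_cupExterior (c : ℕ) : (truncModelAt c).Fact_cupExterior :=
  (toyModel.truncAlgAt_fact_cupExterior_iff c).mpr toyModel_fact_cupExterior
/-- (Ported verbatim from the HodgeCMPerL package; no docstring in the source.) -/
theorem truncModelAt_fact_cup_hodge (c : ℕ) : (truncModelAt c).Fact_cup_hodge :=
  (toyModel.truncAlgAt_fact_cup_hodge_iff c).mpr toyModel_fact_cup_hodge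
/-- (Ported verbatim from the HodgeCMPerL package; no docstring in the source.) -/
theorem truncModelAt_fact_pull_H0 (c : ℕ) : (truncModelAt c).Fact_pull_H0 :=
  (toyModel.truncAlgAt_fact_pull_H0_iff c).mpr toyModel_fact_pull_H0
/-- (Ported verbatim from the HodgeCMPerL package; no docstring in the source.) -/
theorem truncModelAt_fact_hodge_F0 (c : ℕ) : (truncModelAt c).Fact_hodge_F0 :=
  (toyModel.truncAlgAt_fact_hodge_F0_iff c).mpr toyModel_fact_hodge_F0
/-- (Ported verbatim from the HodgeCMPerL package; no docstring in the source.) -/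
theorem truncModelAt_fact_cupAssoc (c : ℕ) : (truncModelAt c).Fact_cupAssoc :=
  (toyModel.truncAlgAt_fact_cupAssoc_iff c).mpr (fact_cupAssoc exteriorHodgeData)
/-- (Ported verbatim from the HodgeCMPerL package; no docstring in the source.) -/
theorem truncModelAt_fact_dimProd (c : ℕ) : (truncModelAt c).Fact_dimProd :=
  (toyModel.truncAlgAt_fact_dimProd_iff c).mpr toyModel_fact_dimProd
/-- (Ported verbatim from the HodgeCMPerL package; no docstring in the source.) -/
theorem truncModelAt_fact_gysinDescent (c : ℕ) : (truncModelAt c).Fact_gysinDescent :=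
  Fact_gysinDescent.truncAlgAt toyModel toyModel_fact_gysinDescent c
/-- (Ported verbatim from the HodgeCMPerL package; no docstring in the source.) -/
theorem truncModelAt_lemma81 (c : ℕ) : (truncModelAt c).Lemma81 :=
  lemma81_truncAlgAt toyModel_modelAxioms toyModel_fact_cupExterior toyModel_fact_cup_hodge toyModel_fact_pull_H0
    toyModel_fact_hodge_F0 c

/-- **In `truncModelAt c` every Hodge class of codimension `≤ c`, on every variety, is algebraic.** -/
theorem truncModelAt_hcUpTo (c : ℕ) : (truncModelAt c).HCUpTo c :=
  (toyModel.truncAlgAt_hcUpTo_iff c).mpr (toyModel.hcUpTo_of_hc (toyModelWith_hc exteriorHodgeData) c)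

/-! ### Headlines -/

/-- **The Hodge conjecture for CM products is not a finite-codimension statement over the model facts**: for every `c`
there is a model of the 28 facts with Pohlmann's theorem (both forms), `W_RK4`, N1–N4, F5, F7d, `Fact_dimProd`, `Lemma81`
and the Hodge conjecture through codimension `c` on ALL varieties, in which the face reduction, [QW8] sufficiency and F4
fail. -/
theorem hc_not_finite_codimension (c : ℕ) :
    ∃ U : Universe, U.ModelAxioms ∧ U.PohlmannSpan ∧ U.PohlmannBasis ∧ U.W_RK4 ∧ U.Fact_cupExterior ∧ U.Fact_cup_hodge ∧
      U.Fact_pull_H0 ∧ U.Fact_hodge_F0 ∧ U.Fact_cupAssoc ∧ U.Fact_gysinDescent ∧ U.Fact_dimProd ∧ U.Lemma81 ∧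
      U.HCUpTo c ∧ ¬ U.FaceReduction ∧ ¬ U.Qw8Sufficiency ∧ ¬ U.Fact_cupAlg := by
  have hc : 2 ≤ max c 2 := le_max_right _ _
  exact ⟨truncModelAt (max c 2), truncModelAt_modelAxioms hc, truncModelAt_pohlmannSpan _, truncModelAt_pohlmannBasis _,
    truncModelAt_w_rk4 hc, truncModelAt_fact_cupExterior _, truncModelAt_fact_cup_hodge _, truncModelAt_fact_pull_H0 _,
    truncModelAt_fact_hodge_F0 _, truncModelAt_fact_cupAssoc _, truncModelAt_fact_gysinDescent _,
    truncModelAt_fact_dimProd _, truncModelAt_lemma81 _,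
    (truncModelAt (max c 2)).hcUpTo_mono (truncModelAt_hcUpTo _) (le_max_left _ _),
    not_truncModelAt_faceReduction hc, not_truncModelAt_qw8Sufficiency hc, not_truncModelAt_fact_cupAlg hc⟩

/-- The same, read as a non-implication. -/
theorem not_faceReduction_of_hcUpTo (c : ℕ) :
    ¬ ∀ U : Universe, U.ModelAxioms → U.PohlmannSpan → U.PohlmannBasis → U.W_RK4 → U.HCUpTo c → U.FaceReduction := by
  intro h
  obtain ⟨U, hM, hP, hB, hW, -, -, -, -, -, -, -, -, hc, hF, -⟩ := hc_not_finite_codimension c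
  exact hF (h U hM hP hB hW hc)

/-- **The cuts `3k + 2` give pairwise distinct toy universes.** -/
theorem truncModelAt_injective : Function.Injective (fun k : ℕ => truncModelAt (3 * k + 2)) :=
  truncAlgAt_injective toyModel_modelAxioms toyModel_fact_cupExterior toyModel_fact_cup_hodge toyModel_fact_pull_H0
    toyModel_fact_hodge_F0 (fun _ _ => toyModelWith_hc exteriorHodgeData _)

/-- **The 28 model facts — together with Pohlmann's theorem, `W_RK4`, N1–N4, F5, F7d, `Fact_dimProd` and `Lemma81` — have
infinitely many pairwise distinct models** (part (6a)(i) of the consistency brief), in each of which [QW8] sufficiency,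
the face reduction and F4 fail. -/
theorem infinitely_many_models :
    ∃ g : ℕ → Universe, Function.Injective g ∧ ∀ k, (g k).ModelAxioms ∧ (g k).PohlmannSpan ∧ (g k).PohlmannBasis ∧
      (g k).W_RK4 ∧ (g k).Fact_cupExterior ∧ (g k).Fact_cup_hodge ∧ (g k).Fact_pull_H0 ∧ (g k).Fact_hodge_F0 ∧
      (g k).Fact_cupAssoc ∧ (g k).Fact_gysinDescent ∧ (g k).Fact_dimProd ∧ (g k).Lemma81 ∧
      ¬ (g k).Qw8Sufficiency ∧ ¬ (g k).FaceReduction ∧ ¬ (g k).Fact_cupAlg :=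
  ⟨fun k => truncModelAt (3 * k + 2), truncModelAt_injective, fun k =>
    have hc : 2 ≤ 3 * k + 2 := by omega
    ⟨truncModelAt_modelAxioms hc, truncModelAt_pohlmannSpan _, truncModelAt_pohlmannBasis _, truncModelAt_w_rk4 hc,
      truncModelAt_fact_cupExterior _, truncModelAt_fact_cup_hodge _, truncModelAt_fact_pull_H0 _,
      truncModelAt_fact_hodge_F0 _, truncModelAt_fact_cupAssoc _, truncModelAt_fact_gysinDescent _,
      truncModelAt_fact_dimProd _, truncModelAt_lemma81 _, not_truncModelAt_qw8Sufficiency hc,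
      not_truncModelAt_faceReduction hc, not_truncModelAt_fact_cupAlg hc⟩⟩

/-- In particular the set of models of the 28 facts is infinite. -/
theorem modelAxioms_models_infinite : {U : Universe | U.ModelAxioms}.Infinite :=
  Set.infinite_of_injective_forall_mem truncModelAt_injective fun k =>
    truncModelAt_modelAxioms (c := 3 * k + 2) (by omega)

end Toy

end HodgeCM

end
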